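import Summits.MatrixMultiplication.MatrixMultiplication.Theses.OctaveBudget
import Summits.MatrixMultiplication.MatrixMultiplication.Theorems.FarEdgeDescentChord
import Summits.MatrixMultiplication.MatrixMultiplication.Theorems.FarEdgeDescentGlue
import Literature.Computability.AlgebraicComplexity.BigCwFourthOmega
import HarnessLib

/-!
# OctaveBudgetLinearDecayTwoUpToFive — the first base-range rung of the octave budget
(decomp-mm cell, lens 5 «finite/base range + asymptotic regime + bridge», generation 10)

Landing form for item `stmt-MatrixMultiplication-25357` of `route-MatrixMultiplication-OctaveBudget`
(`Theses/OctaveBudget.lean`):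

* `linearDecayTwoUpToFive_holds : LinearDecayTwoUpToFive` — the linear-decay law with constant `2`,
  `e(k) := ω(1,k,1) − (k+1) ≤ 2/k`, on the base range `1 ≤ k ≤ 5`.

Proof.  The excess `e` is antitone (landed `FarEdgeDescentChord.excess_antitone`) and nonnegative
(landed `FarEdgeDescentGlue.excess_nonneg`), and `e(1) = ω − 2 ≤ 0.37295` (`omegaRect_one_one_one` and
Le Gall's bound `LeGall2014_cw4_omega_le`); hence `e(k) ≤ e(1) ≤ 0.37295 ≤ 2/5 ≤ 2/k` for `k ≤ 5`
(`rung_of_tail_bound`, stated generally: a uniform tail bound `e ≤ η` on `[κ₀, ∞)` with `η K ≤ C`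
extends a rung `(C, k₁)` to `(C, K)`).  No table of rectangular exponents is used.

Lens reading: `LinearDecayTwoUpToFive` is the FINITE RANGE of the octave budget `LinearExcessDecay`
(`∃ C, ∀ k ≥ 1, e(k) ≤ C/k`) at `C = 2`; the ASYMPTOTIC REGIME is Coppersmith's `e(k) → 0`
(`FarEdgeDescent.RateVanishes`); the bridge that would make a finite range bite is the route's crux
`TailSubcriticalDoubling` — by itself no finite range decides the budget.

References: [cite: LeGall2014, Thm 1.1]; [cite: Coppersmith1997, Thm 1]; [cite: HuangPan1998, §8].
-/

set_option linter.dupNamespace false -- `MatrixMultiplication.MatrixMultiplication` (summit = problem, D-0017)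

noncomputable section

namespace Summit.MatrixMultiplication.MatrixMultiplication.Theorems.OctaveBudgetLinearDecayTwoUpToFive

open Literature.Computability.AlgebraicComplexity
open Summit.MatrixMultiplication.MatrixMultiplication.Theses.OctaveBudget

-- `excess_nonneg : 0 ≤ e(x)` and `excess_antitone : y ≤ x → e(x) ≤ e(y)` are the landed
-- `FarEdgeDescentGlue.excess_nonneg` / `FarEdgeDescentChord.excess_antitone` (reused, not restated).
open Summit.MatrixMultiplication.MatrixMultiplication.Theorems.FarEdgeDescentGlue (excess_nonneg)
open Summit.MatrixMultiplication.MatrixMultiplication.Theorems.FarEdgeDescentChord (excess_antitone)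

/-- Every excess on `[1, ∞)` is at most `0.37295` (`e(p) ≤ e(1) = ω − 2`, Le Gall 2014). -/
theorem excess_le {p : ℝ} (hp : 1 ≤ p) : omegaRect ℂ 1 p 1 - (p + 1) ≤ 0.37295 := by
  refine (excess_antitone hp).trans ?_
  rw [omegaRect_one_one_one]
  have h := LeGall2014_cw4_omega_le ℂ
  norm_num at h ⊢
  linarith

/-- Generic rung extension: from a rung `(C, k₁)`, a uniform tail bound `e ≤ η` on `[κ₀, ∞)` with
`κ₀ ≤ k₁ + 1` and `η K ≤ C`, the rung `(C, K)` follows. -/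
theorem rung_of_tail_bound {C η κ₀ : ℝ} {K k₁ : ℕ}
    (hlow : ∀ k : ℕ, 1 ≤ k → k ≤ k₁ → omegaRect ℂ 1 k 1 - (k + 1) ≤ C / k)
    (hκ : κ₀ ≤ (k₁ : ℝ) + 1) (hη : omegaRect ℂ 1 κ₀ 1 - (κ₀ + 1) ≤ η) (hC : η * K ≤ C) :
    ∀ k : ℕ, 1 ≤ k → k ≤ K → omegaRect ℂ 1 k 1 - (k + 1) ≤ C / k := by
  intro k hk hkK
  by_cases hk1 : k ≤ k₁
  · exact hlow k hk hk1
  · push Not at hk1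
    have hk' : κ₀ ≤ (k : ℝ) := by
      have : (k₁ : ℝ) + 1 ≤ (k : ℝ) := by exact_mod_cast hk1
      linarith
    have hkpos : (0 : ℝ) < (k : ℝ) := by
      have : (1 : ℝ) ≤ (k : ℝ) := by exact_mod_cast hk
      linarith
    have hkK' : (k : ℝ) ≤ (K : ℝ) := by exact_mod_cast hkK
    have hmono := (excess_antitone hk').trans hη
    have hη0 : 0 ≤ η := (excess_nonneg (k : ℝ)).trans hmono
    rw [le_div_iff₀ hkpos]
    nlinarith [mul_nonneg (sub_nonneg.2 hmono) hkpos.le, mul_nonneg hη0 (sub_nonneg.2 hkK')]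

/-- Rung `(2, 5)` from the square record alone: `0.37295 · 5 ≤ 2`. -/
theorem rung_two_five : ∀ k : ℕ, 1 ≤ k → k ≤ 5 → omegaRect ℂ 1 k 1 - (k + 1) ≤ 2 / k :=
  rung_of_tail_bound (k₁ := 0) (κ₀ := 1) (η := 0.37295) (C := 2)
    (fun k hk hk0 => by omega) (by norm_num) (excess_le le_rfl) (by norm_num)

/-- Item `stmt-MatrixMultiplication-25357`: the linear-decay law with constant `2` on `1 ≤ k ≤ 5`. -/
theorem linearDecayTwoUpToFive_holds : LinearDecayTwoUpToFive := rung_two_five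

end Summit.MatrixMultiplication.MatrixMultiplication.Theorems.OctaveBudgetLinearDecayTwoUpToFive

end
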